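import Literature.Claims.NS.Tarver2016
import Summits.NavierStokesRegularity.NavierStokesRegularity.Theorems.SoloRefuteChio2026
import Literature.Analysis.FluidPDE.VorticityStretching
import HarnessLib

/-!
# Refutation of the typed steps of Tarver (2016) (NS-claims census C80)

Claim file: `Literature.Claims.NS.Tarver2016` (T. Tarver, *Existence and smoothness of the Navier–Stokes
equation in three dimensions* (2016); typed skeleton `Literature/Claims/NS/Tarver2016.lean`, whose
`ClaimedTheorem` is Clay (A) token for token).

Two kernel faces (kit written by ns-claims-typist-1 g2, `KillKit-Tarver2016-typist1.lean`
sha16 2378e5e39e1c27d0, adopted by the refuter of record ns-claims-refuter-7 with statement types written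
out in full and docstrings added; the mathematics is the typist's):

* `not_WaveGivesNSAbs` — the LOAD-BEARING Step 3 at the abstract grain
  (`Literature.Claims.NS.Tarver2016.WaveGivesNSAbs`; pp.5–7: «we have the solution to the
  three-dimensional simple wave equation where u⃗ = φ and u⃗ₜ = ψ initially … Since the pressure p is being
  eliminated and the stream function exists, the velocity u⃗ exists»): the standing shear wave
  `W(t,x) = cos(√ν t) sin(x₁) e₀` is a smooth global solution of `∂ₜ²W = νΔW` from the smooth
  divergence-free datum `sin(x₁) e₀` with `∂ₜW(0) = 0`, yet no pressure makes it a Navier–Stokes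
  velocity: at `t = 0` the momentum equation forces `∇p(0,·) = −ν sin(x₁) e₀`, which is not a gradient
  (`no_potential`: a potential would be constant along `e₁` and drop by `ν sin(a₁)` per unit step along
  `e₀`; compare the steps at `a = 0` and `a = (π/2)e₁`).
* `not_NSIsWave` — Step 1 (`Literature.Claims.NS.Tarver2016.NSIsWave`; p.6 col.2 «∂²u⃗ᵢ/∂t² = νΔu⃗ᵢ …
  "The Simple Wave equation"»; p.3 col.2): the heat shear `u = e^{−νt} sin(x₁) e₀`, `p ≡ 0` is a smooth
  Navier–Stokes solution with `∂ₜ²u = ν²u ≠ νΔu = −νu`.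

The consumed Clay-grain twin `Literature.Claims.NS.Tarver2016.WaveGivesNS` (same sentences, datum of
Clay's class (4)) is NOT decided here: a kernel countermodel there needs a closed-form smooth solution of
the 3D wave equation with rapidly decaying data, which the tree does not hold (two-grain pattern, cf.
the census rows C41/C13b).

Shear-profile calculus (`modeU`, `fderiv_modeU`, `laplacian_modeU`, …) is reused from the C55 kill file
`…Theorems.SoloRefuteChio2026`.

WHAT THIS IS NOT: not a statement about the Navier–Stokes problem itself; not about any author beyond
the typed locator.
-/

noncomputable section

open Set InnerProductSpace
open Literature.Analysis.FluidPDE Literature.Claims.NS.Tarver2016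
open Summit.NavierStokesRegularity.NavierStokesRegularity.Theorems.Chio2026 (e0 P1 shearL modeU
  contDiff_modeU hasFDerivAt_modeU fderiv_modeU laplacian_modeU)
open scoped RealInnerProductSpace Laplacian ContDiff

-- The summit's canonical theorem namespace repeats the summit name (single-conjunct summit).
set_option linter.dupNamespace false

namespace Summit.NavierStokesRegularity.NavierStokesRegularity.Theorems.Tarver2016

/-- Standard basis vector. -/
abbrev bv (j : Fin 3) : EuclideanSpace ℝ (Fin 3) := EuclideanSpace.single j (1 : ℝ)

/-! ## Shared facts about the shear profile `modeU a = (a sin x₁) e₀` (from the C55 kill file) -/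

/-- `modeU a` is divergence-free (tree notion `NSWave0.divergence`). -/
theorem isDivFree_modeU (a : ℝ) : NSWave0.IsDivFree (modeU a) := by
  intro x
  rw [NSWave0.divergence, fderiv_modeU, trace_eq_sum_coord, Fin.sum_univ_three]
  simp [shearL, e0, P1]

/-- `(modeU a · ∇) modeU b = 0`. -/
theorem convective_modeU (a b : ℝ) (x : EuclideanSpace ℝ (Fin 3)) :
    fderiv ℝ (modeU b) x (modeU a x) = 0 := by
  rw [fderiv_modeU]
  simp [shearL, e0, P1, modeU]

/-- A time-modulated shear `(t, x) ↦ modeU (c t) x` is smooth on the half-space when `c` is smooth. -/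
theorem smooth_modulated {c : ℝ → ℝ} (hc : ContDiff ℝ ∞ c) :
    IsSmoothOnHalfSpace (fun t x => modeU (c t) x) := by
  have e : Function.uncurry (fun (t : ℝ) (x : EuclideanSpace ℝ (Fin 3)) => modeU (c t) x) =
      fun p : ℝ × EuclideanSpace ℝ (Fin 3) => (c p.1 * Real.sin (p.2 1)) • e0 := by
    funext p; rfl
  have h1 : ContDiff ℝ ∞ (fun p : ℝ × EuclideanSpace ℝ (Fin 3) => c p.1 * Real.sin (p.2 1)) :=
    (hc.comp contDiff_fst).mul (Real.contDiff_sin.comp (P1.contDiff.comp contDiff_snd))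
  have h : ContDiff ℝ ∞ (Function.uncurry fun (t : ℝ) (x : EuclideanSpace ℝ (Fin 3)) => modeU (c t) x) := by
    rw [e]; exact h1.smul contDiff_const
  exact h.contDiffOn

/-- Time derivative of a modulated shear: `∂ₛ modeU (c s) x = (c' s · sin x₁) e₀`. -/
theorem hasDerivAt_modulated {c : ℝ → ℝ} {c' s : ℝ} (hc : HasDerivAt c c' s)
    (x : EuclideanSpace ℝ (Fin 3)) :
    HasDerivAt (fun r => modeU (c r) x) ((c' * Real.sin (x 1)) • e0) s := by
  have := (hc.mul_const (Real.sin (x 1))).smul_const e0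
  simpa [modeU] using this

/-! ## Face 1: `¬ WaveGivesNSAbs` — the standing shear wave -/

/-- The standing shear wave `W(t, x) = cos(√ν t) sin(x₁) e₀`. -/
def standingWave (ν : ℝ) : ℝ → EuclideanSpace ℝ (Fin 3) → EuclideanSpace ℝ (Fin 3) :=
  fun t x => modeU (Real.cos (Real.sqrt ν * t)) x

/-- The standing wave is smooth on the closed half-space. [folklore] -/
theorem standingWave_smooth (ν : ℝ) : IsSmoothOnHalfSpace (standingWave ν) :=
  smooth_modulated ((Real.contDiff_cos.comp (contDiff_const.mul contDiff_id)))

/-- `d/ds cos(√ν s) = −√ν sin(√ν s)`. [folklore] -/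
theorem hasDerivAt_cosMod (ν s : ℝ) :
    HasDerivAt (fun r : ℝ => Real.cos (Real.sqrt ν * r)) (-(Real.sqrt ν * Real.sin (Real.sqrt ν * s))) s := by
  have h1 : HasDerivAt (fun r : ℝ => Real.sqrt ν * r) (Real.sqrt ν) s := by
    simpa using (hasDerivAt_id s).const_mul (Real.sqrt ν)
  have h2 : HasDerivAt (fun r : ℝ => Real.cos (Real.sqrt ν * r))
      (-Real.sin (Real.sqrt ν * s) * Real.sqrt ν) s := (Real.hasDerivAt_cos _).comp s h1
  convert h2 using 1
  ring

/-- `d/ds sin(√ν s) = √ν cos(√ν s)`. [folklore] -/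
theorem hasDerivAt_sinMod (ν s : ℝ) :
    HasDerivAt (fun r : ℝ => Real.sin (Real.sqrt ν * r)) (Real.sqrt ν * Real.cos (Real.sqrt ν * s)) s := by
  have h1 : HasDerivAt (fun r : ℝ => Real.sqrt ν * r) (Real.sqrt ν) s := by
    simpa using (hasDerivAt_id s).const_mul (Real.sqrt ν)
  have h2 : HasDerivAt (fun r : ℝ => Real.sin (Real.sqrt ν * r))
      (Real.cos (Real.sqrt ν * s) * Real.sqrt ν) s := (Real.hasDerivAt_sin _).comp s h1
  convert h2 using 1
  ring

/-- First time derivative of the standing wave (everywhere). -/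
theorem hasDerivAt_standingWave (ν s : ℝ) (x : EuclideanSpace ℝ (Fin 3)) :
    HasDerivAt (fun r => standingWave ν r x)
      ((-(Real.sqrt ν * Real.sin (Real.sqrt ν * s)) * Real.sin (x 1)) • e0) s :=
  hasDerivAt_modulated (hasDerivAt_cosMod ν s) x

/-- The time derivative of the standing wave as a function. [folklore] -/
theorem deriv_standingWave (ν : ℝ) (x : EuclideanSpace ℝ (Fin 3)) :
    deriv (fun r => standingWave ν r x) =
      fun s => ((-(Real.sqrt ν * Real.sin (Real.sqrt ν * s))) * Real.sin (x 1)) • e0 :=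
  funext fun s => (hasDerivAt_standingWave ν s x).deriv

/-- Second time derivative of the standing wave: `−ν W` (for `ν ≥ 0`). -/
theorem iteratedDeriv_two_standingWave {ν : ℝ} (hν : 0 ≤ ν) (t : ℝ) (x : EuclideanSpace ℝ (Fin 3)) :
    iteratedDeriv 2 (fun r => standingWave ν r x) t =
      (-(ν * Real.cos (Real.sqrt ν * t)) * Real.sin (x 1)) • e0 := by
  rw [iteratedDeriv_succ, iteratedDeriv_one, deriv_standingWave]
  have h : HasDerivAt (fun s : ℝ => ((-(Real.sqrt ν * Real.sin (Real.sqrt ν * s))) * Real.sin (x 1)) • e0)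
      (((-(Real.sqrt ν * (Real.sqrt ν * Real.cos (Real.sqrt ν * t)))) * Real.sin (x 1)) • e0) t :=
    (((hasDerivAt_sinMod ν t).const_mul (Real.sqrt ν)).neg.mul_const (Real.sin (x 1))).smul_const e0
  rw [h.deriv]
  congr 1
  have : Real.sqrt ν * Real.sqrt ν = ν := Real.mul_self_sqrt hν
  rw [← mul_assoc, this]

/-- The standing wave solves the Simple Wave equation `∂ₜ²W = νΔW`. -/
theorem standingWave_isWaveSolution {ν : ℝ} (hν : 0 ≤ ν) :
    Literature.Claims.NS.Tarver2016.IsWaveSolution ν (standingWave ν) := by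
  intro t _ x
  rw [iteratedDeriv_two_standingWave hν]
  show _ = ν • (Δ (modeU (Real.cos (Real.sqrt ν * t)))) x
  rw [laplacian_modeU, smul_smul]
  congr 1
  ring

/-- At `t = 0` the standing wave is the datum `sin(x₁) e₀`. [folklore] -/
theorem standingWave_zero (ν : ℝ) : standingWave ν 0 = modeU 1 := by
  funext x; simp [standingWave]

/-- `∂ₜW(0) = 0` (one-sided derivative on `[0,∞)`). [folklore] -/
theorem derivWithin_standingWave_zero (ν : ℝ) (x : EuclideanSpace ℝ (Fin 3)) :
    derivWithin (fun s => standingWave ν s x) (Ici 0) 0 = 0 := by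
  rw [(hasDerivAt_standingWave ν 0 x).hasDerivWithinAt.derivWithin (uniqueDiffOn_Ici 0 0 Set.self_mem_Ici)]
  simp

/-- A smooth-on-the-half-space pressure has differentiable time slices. [folklore] -/
theorem differentiable_slice {P : ℝ → EuclideanSpace ℝ (Fin 3) → ℝ} (hP : IsSmoothOnHalfSpace P)
    {t : ℝ} (ht : 0 ≤ t) : Differentiable ℝ (P t) := by
  have hmap : MapsTo (fun x : EuclideanSpace ℝ (Fin 3) => (t, x)) univ
      (Ici (0 : ℝ) ×ˢ (univ : Set (EuclideanSpace ℝ (Fin 3)))) := fun x _ => ⟨ht, mem_univ _⟩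
  have hc : ContDiffOn ℝ ∞ (fun x : EuclideanSpace ℝ (Fin 3) => Function.uncurry P (t, x)) univ :=
    hP.comp (contDiff_prodMk_right t).contDiffOn hmap
  have : ContDiff ℝ ∞ (P t) := by
    simpa [Function.uncurry, contDiffOn_univ] using hc
  exact this.differentiable (by simp)

/-- Line derivative of a potential. [folklore] -/
theorem hasDerivAt_line {Q : EuclideanSpace ℝ (Fin 3) → ℝ} (hQ : Differentiable ℝ Q)
    (a v : EuclideanSpace ℝ (Fin 3)) (s : ℝ) :
    HasDerivAt (fun s : ℝ => Q (a + s • v)) ⟪gradient Q (a + s • v), v⟫ s := by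
  have hl : HasDerivAt (fun s : ℝ => a + s • v) v s := by
    simpa using ((hasDerivAt_id s).smul_const v).const_add a
  have h : HasDerivAt (fun s : ℝ => Q (a + s • v)) (fderiv ℝ Q (a + s • v) v) s :=
    (hQ (a + s • v)).hasFDerivAt.comp_hasDerivAt s hl
  have e : fderiv ℝ Q (a + s • v) v = ⟪gradient Q (a + s • v), v⟫ := by
    rw [gradient, ← toDual_apply_apply, (toDual ℝ (EuclideanSpace ℝ (Fin 3))).apply_symm_apply]
  rwa [e] at h

/-- The obstruction: no differentiable `Q : ℝ³ → ℝ` has gradient `x ↦ (−ν sin x₁) e₀` when `ν ≠ 0`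
(`∂₁` of the first component is `−ν cos x₁ ≢ 0 = ∂₀` of the second). -/
theorem no_potential {ν : ℝ} (hν : ν ≠ 0) {Q : EuclideanSpace ℝ (Fin 3) → ℝ} (hQ : Differentiable ℝ Q)
    (hgrad : ∀ x : EuclideanSpace ℝ (Fin 3), gradient Q x = (-(ν * Real.sin (x 1))) • e0) : False := by
  -- (i) `Q` is constant along `e₁`
  have hconst1 : ∀ (a : EuclideanSpace ℝ (Fin 3)) (s : ℝ), Q (a + s • bv 1) = Q a := by
    intro a s
    have hd : ∀ r : ℝ, deriv (fun r : ℝ => Q (a + r • bv 1)) r = 0 := fun r => by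
      rw [(hasDerivAt_line hQ a (bv 1) r).deriv, hgrad]
      simp [e0, EuclideanSpace.inner_single_right]
    have hdiff : Differentiable ℝ (fun r : ℝ => Q (a + r • bv 1)) := fun r =>
      (hasDerivAt_line hQ a (bv 1) r).differentiableAt
    simpa using is_const_of_deriv_eq_zero hdiff hd s 0
  -- (ii) along `e₀`: `Q(a + s e₀) = Q(a) − ν sin(a₁) s`
  have hlin0 : ∀ (a : EuclideanSpace ℝ (Fin 3)) (s : ℝ), Q (a + s • bv 0) = Q a - ν * Real.sin (a 1) * s := by
    intro a s
    have hd : ∀ r : ℝ, deriv (fun r : ℝ => Q (a + r • bv 0) + ν * Real.sin (a 1) * r) r = 0 := fun r => by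
      have h1 := hasDerivAt_line hQ a (bv 0) r
      have h2 : HasDerivAt (fun r : ℝ => ν * Real.sin (a 1) * r) (ν * Real.sin (a 1)) r := by
        simpa using (hasDerivAt_id r).const_mul (ν * Real.sin (a 1))
      have h12 : HasDerivAt (fun r : ℝ => Q (a + r • bv 0) + ν * Real.sin (a 1) * r)
          (⟪gradient Q (a + r • bv 0), bv 0⟫ + ν * Real.sin (a 1)) r := h1.add h2
      rw [h12.deriv, hgrad]
      simp [e0, EuclideanSpace.inner_single_right, inner_neg_left]
    have hdiff : Differentiable ℝ (fun r : ℝ => Q (a + r • bv 0) + ν * Real.sin (a 1) * r) := fun r =>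
      ((hasDerivAt_line hQ a (bv 0) r).add
        (by simpa using (hasDerivAt_id r).const_mul (ν * Real.sin (a 1)))).differentiableAt
    have := is_const_of_deriv_eq_zero hdiff hd s 0
    simp at this
    linarith
  -- combine at `m = (π/2) e₁`
  set m : EuclideanSpace ℝ (Fin 3) := (Real.pi / 2) • bv 1 with hm
  have hm1 : Real.sin (m 1) = 1 := by simp [hm]
  have hA : Q (bv 0) = Q 0 := by
    have := hlin0 0 1
    simpa using this
  have hB : Q (m + bv 0) = Q m - ν := by
    have := hlin0 m 1
    rw [hm1] at this
    simpa using this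
  have hC : Q (m + bv 0) = Q (bv 0) := by
    have := hconst1 (bv 0) (Real.pi / 2)
    rw [← hm] at this
    simpa [add_comm] using this
  have hD : Q m = Q 0 := by
    have := hconst1 0 (Real.pi / 2)
    rw [← hm] at this
    simpa using this
  exact hν (by linarith [hA, hB, hC, hD])

/-- **KILL (face 1): `¬ WaveGivesNSAbs`.** The standing shear wave is a smooth global solution of the
Simple Wave equation issued from the smooth divergence-free datum `sin(x₁) e₀` with `∂ₜW(0) = 0`, but it
is not a Navier–Stokes velocity for any pressure: at `t = 0` the momentum equation would force
`∇p(0,·) = νΔW − ∂ₜW − (W·∇)W = −ν sin(x₁) e₀`, which is not a gradient. -/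
theorem not_WaveGivesNSAbs : ¬ Literature.Claims.NS.Tarver2016.WaveGivesNSAbs := by
  intro h
  have hν : (0 : ℝ) < 1 := one_pos
  obtain ⟨p, hp, hns⟩ := h 1 (modeU 1) (standingWave 1) hν (contDiff_modeU 1) (isDivFree_modeU 1)
    (standingWave_smooth 1) (standingWave_isWaveSolution zero_le_one) (standingWave_zero 1)
    (derivWithin_standingWave_zero 1)
  have hQ : Differentiable ℝ (p 0) := differentiable_slice hp le_rfl
  refine no_potential one_ne_zero hQ fun x => ?_
  have hmom := hns.momentum 0 le_rfl x
  rw [derivWithin_standingWave_zero 1 x] at hmom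
  have hconv : fderiv ℝ (standingWave 1 0) x (standingWave 1 0 x) = 0 := by
    rw [standingWave_zero]; exact convective_modeU 1 1 x
  have hlap : (Δ (standingWave 1 0)) x = (-(Real.sin (x 1))) • e0 := by
    rw [standingWave_zero, laplacian_modeU]; simp
  rw [hconv, hlap] at hmom
  -- hmom : 0 + 0 = 1 • (−sin x₁) e₀ − ∇p + 0
  have : gradient (p 0) x = (-(Real.sin (x 1))) • e0 := by
    have h' := hmom
    simp only [Pi.zero_apply, add_zero, one_smul] at h'
    -- h' : 0 = -(sin) • e0 - gradient (p 0) x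
    exact (sub_eq_zero.mp h'.symm).symm
  simpa using this

/-! ## Face 2: `¬ NSIsWave` — the heat shear -/

/-- The heat shear `u(t, x) = e^{−νt} sin(x₁) e₀` (an exact Navier–Stokes solution with `p ≡ 0`). -/
def heatShear (ν : ℝ) : ℝ → EuclideanSpace ℝ (Fin 3) → EuclideanSpace ℝ (Fin 3) :=
  fun t x => modeU (Real.exp (-ν * t)) x

/-- `d/ds e^{−νs} = −ν e^{−νs}`. [folklore] -/
theorem hasDerivAt_expMod (ν s : ℝ) :
    HasDerivAt (fun r : ℝ => Real.exp (-ν * r)) (-ν * Real.exp (-ν * s)) s := by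
  have h1 : HasDerivAt (fun r : ℝ => -ν * r) (-ν) s := by
    simpa using (hasDerivAt_id s).const_mul (-ν)
  have h2 : HasDerivAt (fun r : ℝ => Real.exp (-ν * r)) (Real.exp (-ν * s) * -ν) s :=
    (Real.hasDerivAt_exp _).comp s h1
  convert h2 using 1
  ring

/-- The heat shear is smooth on the closed half-space. [folklore] -/
theorem heatShear_smooth (ν : ℝ) : IsSmoothOnHalfSpace (heatShear ν) :=
  smooth_modulated (Real.contDiff_exp.comp (contDiff_const.mul contDiff_id))

/-- Time derivative of the heat shear. [folklore] -/
theorem hasDerivAt_heatShear (ν s : ℝ) (x : EuclideanSpace ℝ (Fin 3)) :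
    HasDerivAt (fun r => heatShear ν r x) ((-ν * Real.exp (-ν * s) * Real.sin (x 1)) • e0) s :=
  hasDerivAt_modulated (hasDerivAt_expMod ν s) x

/-- The time derivative of the heat shear as a function. [folklore] -/
theorem deriv_heatShear (ν : ℝ) (x : EuclideanSpace ℝ (Fin 3)) :
    deriv (fun r => heatShear ν r x) = fun s => ((-ν * Real.exp (-ν * s)) * Real.sin (x 1)) • e0 :=
  funext fun s => (hasDerivAt_heatShear ν s x).deriv

/-- Second time derivative of the heat shear: `ν² u`. [folklore] -/
theorem iteratedDeriv_two_heatShear (ν t : ℝ) (x : EuclideanSpace ℝ (Fin 3)) :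
    iteratedDeriv 2 (fun r => heatShear ν r x) t = (ν ^ 2 * Real.exp (-ν * t) * Real.sin (x 1)) • e0 := by
  rw [iteratedDeriv_succ, iteratedDeriv_one, deriv_heatShear]
  have h : HasDerivAt (fun s : ℝ => ((-ν * Real.exp (-ν * s)) * Real.sin (x 1)) • e0)
      (((-ν * (-ν * Real.exp (-ν * t))) * Real.sin (x 1)) • e0) t :=
    (((hasDerivAt_expMod ν t).const_mul (-ν)).mul_const (Real.sin (x 1))).smul_const e0
  rw [h.deriv]
  congr 1
  ring

/-- The heat shear with zero pressure solves (1)–(3) with `f ≡ 0` from the datum `sin(x₁) e₀`. -/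
theorem heatShear_isNS {ν : ℝ} : IsNavierStokesSolution ν 0 (modeU 1) (heatShear ν) (fun _ _ => 0) := by
  refine ⟨fun t ht x => ?_, fun t _ => ?_, ?_⟩
  · rw [(hasDerivAt_heatShear ν t x).hasDerivWithinAt.derivWithin (uniqueDiffOn_Ici 0 t ht)]
    have hconv : fderiv ℝ (heatShear ν t) x (heatShear ν t x) = 0 := convective_modeU _ _ x
    have hlap : (Δ (heatShear ν t)) x = (-(Real.exp (-ν * t) * Real.sin (x 1))) • e0 :=
      laplacian_modeU _ x
    have hgrad : gradient (fun _ : EuclideanSpace ℝ (Fin 3) => (0 : ℝ)) x = 0 := by simp [gradient]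
    rw [hconv, hlap, hgrad]
    simp only [Pi.zero_apply, add_zero, sub_zero, smul_smul]
    congr 1
    ring
  · exact isDivFree_modeU _
  · funext x; simp [heatShear]

/-- **KILL (face 2): `¬ NSIsWave`.** The heat shear is a smooth Navier–Stokes solution (with `p ≡ 0`),
but `∂ₜ²u = ν²u` while `νΔu = −νu`: at `t = 1`, `x = (π/2) e₁` the wave equation would give
`ν² e^{−ν} = −ν e^{−ν}`, impossible for `ν = 1`. -/
theorem not_NSIsWave : ¬ Literature.Claims.NS.Tarver2016.NSIsWave := by
  intro h
  have hw := h 1 (modeU 1) (heatShear 1) (fun _ _ => 0) one_pos (heatShear_smooth 1)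
    (contDiffOn_const) heatShear_isNS
  have key := hw 1 one_pos ((Real.pi / 2) • bv 1)
  rw [iteratedDeriv_two_heatShear] at key
  have hlap : (Δ (heatShear 1 1)) ((Real.pi / 2) • bv 1) =
      (-(Real.exp (-1 * 1) * Real.sin (((Real.pi / 2) • bv 1 : EuclideanSpace ℝ (Fin 3)) 1))) • e0 :=
    laplacian_modeU _ _
  rw [hlap] at key
  have hsin : Real.sin (((Real.pi / 2) • bv 1 : EuclideanSpace ℝ (Fin 3)) 1) = 1 := by simp
  rw [hsin] at key
  -- compare the `e₀`-components
  have hc := congrArg (fun v : EuclideanSpace ℝ (Fin 3) => v 0) key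
  simp [e0] at hc
  have hpos : 0 < Real.exp (-1 : ℝ) := Real.exp_pos _
  nlinarith [hc, hpos]

end Summit.NavierStokesRegularity.NavierStokesRegularity.Theorems.Tarver2016

end
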